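import Mathlib
import HarnessLib
import Summits.HubbardSuperconductivity.HubbardSuperconductivity.Theorems.KLProgrammeSWaveCascadeClosedForm

/-!
# Route `KLProgramme` — row 0′ (child 1): PINNED DOMINATION of the repulsive cascade — the decrements of the comparison sequence at ANY transfer are
# dominated by the decrements AT THE PIN, so «sup over transfers, read at the pin» is `U`-currency (E1 docket (5′)(s2) «SUP-VS-PIN», conversion half)

Cell gate-hubbard-kl, seat hubbard-kl-k3c1-p1 (g20; child-1 lineage; technique «composed-map remainder propagation» — `klcrf_compose/lipschitz_weighted` in cascade form).
Sequel to `…SWaveCascadeAllScales` §1 (p701157: the cascade `U_{n+1} = U_n/(1 + W_n U_n)` under the negative-mass floor, total variation `≤ (257/225)·U_0`) and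
`…SWaveCascadeClosedForm` (p704335: `1/U_n = 1/U_0 + Σ_{j<n} W_j`, the two-cascade identity `U_n − U'_n = U_n·U'_n·Σ_{j<n}(W'_j − W_j)`).

Context (pen g25 (R366)/(R386)(B)/(R389)(B); k3c2-p3 g16's brick (T2) `…EngineTowerImportP2PlainFromValues`, hypothesis (s2) «SUP-VS-PIN»): the norm side of «S3 IN U-CURRENCY»
pays the plain four-leg line of a superposition `Σ_i a_i·B_i` of pair-transfer bumps by `Σ_i ‖a_i‖·sup|G_i|`; the value side (this lineage, rows 3/6/7) hands, PER TRANSFER `q`,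
a comparison sequence `u_·(q)` with the exact law and `U`-currency total variation.  (s2) asks that the SUP OVER TRANSFERS of the scale-`n` decrement be read at the pinned
transfer `o`.  An ADDITIVE comparison `Δu_n(q) ≈ Δu_n(o)` is NOT available in `U`-currency (a plain modulus `Σ_n sup_q |W_n(q) − W_n(o)|` of the net masses is `O(n·b)` by the
class-edge effect); what converts is RATIO domination.  THIS FILE (generic real analysis, no model content):

* §1 two cascades `U` (pin, masses `W`) and `U'` (transfer, masses `W'`) from the same `U_0 ≥ 0`, both under the floor: if the cumulative SHORTFALL of the transfer's masses
  is bounded, `Σ_{j<n}(W_j − W'_j) ≤ Θ`, then **`U'_n·(1 − U_n·Θ) ≤ U_n`** (`sWaveFloor_le_of_shortfall`) and, for `D ≥ 1` with `D·(16U_0/15)·Θ ≤ D − 1`, **`U'_n ≤ D·U_n`**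
  (`sWaveFloor_le_mul_of_shortfall`); if moreover the transfer's mass is dominated by the pinned one, `|W'_n| ≤ κ·|W_n| + η`, then the DECREMENT is dominated:
  **`|U'_{n+1} − U'_n| ≤ D²·(κ·|U_{n+1} − U_n| + (16U_0/15)²·η)`** (`sWaveFloor_succ_sub_dominated`), and summing — frozen steps `W'_n = 0` allowed, where nothing is asked —
  **`Σ_{n<N} |U'_{n+1} − U'_n| ≤ D²·(κ·(257/225)·U_0 + (16U_0/15)²·Σ_{n<N} η_n)`** (`sWaveFloor_totalVariation_dominated`);
* §2 the family form over an index of transfers with a pin `o` (`cascadeFamily_decrement_dominated`, **`cascadeFamily_exists_pinnedAmplitude`**): there are amplitudes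
  `a_n := D²(κ·|U_o(n+1) − U_o(n)| + (16U_0/15)²·η_n)` READ AT THE PIN with `|U_q(n+1) − U_q(n)| ≤ a_n` for every dominated transfer `q` and
  `Σ_{n<N} a_n ≤ D²(κ·(257/225)·U_0 + (16U_0/15)²·Ση)` — the shape of (T2)'s `hV` with `G_n := Δu_·(n)/a_n`, `sup|G_n| ≤ 1`; the `D = 2` instance under `(32/15)·U_0·Θ ≤ 1`
  (`cascadeFamily_exists_pinnedAmplitude_two`).

What remains the E1 producer's ((5′)): NAME the (E2-F2) net masses and prove the two mass-level inputs (D1) `|W_n(q)| ≤ κ|W_n(o)| + η_n` (the pp slice is maximal at zero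
transfer up to the sign defect) and (D2) the shortfall `Σ_{j<n}(W_j(o) − W_j(q)) ≤ Θ` on the class; and (s1)/(s3).  Everything is proved; no definitions; nothing about the model is
asserted; nothing asserts (X).1, any open stub, K3 or superconductivity. [folklore]
-/

noncomputable section

namespace Summit.HubbardSuperconductivity.HubbardSuperconductivity.Theorems.SWaveCascade

set_option linter.dupNamespace false -- summit = problem name (single-conjunct summit), D-0017

open Finset

/-! ## §1 Two cascades from the same initial value: shortfall comparison and dominated decrements -/

section Scalar

variable {U U' W W' ν ν' : ℕ → ℝ} {N : ℕ}

/-- A frozen step does not move the cascade: `W_n = 0 ⟹ U_{n+1} = U_n`. [folklore] -/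
theorem sWaveCascade_succ_eq_of_mass_zero (hU : ∀ n, U (n + 1) = U n / (1 + W n * U n)) {n : ℕ} (hz : W n = 0) :
    U (n + 1) = U n := by
  rw [hU n, hz]; simp

/-- **Shortfall comparison.**  Two cascades from the same `U_0 ≥ 0` under the negative-mass floor; if the cumulative shortfall of the second one's masses is
bounded, `Σ_{j<n}(W_j − W'_j) ≤ Θ`, then `U'_n·(1 − U_n·Θ) ≤ U_n` (less screening raises the comparison value by at most the factor `1/(1 − U_nΘ)`). [folklore] -/
theorem sWaveFloor_le_of_shortfall (h0 : 0 ≤ U 0) (h0' : U' 0 = U 0)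
    (hU : ∀ n, U (n + 1) = U n / (1 + W n * U n)) (hWν : ∀ n, -ν n ≤ W n) (hν0 : ∀ n, 0 ≤ ν n)
    (hsmall : 16 * U 0 * ∑ j ∈ range N, ν j ≤ 1)
    (hU' : ∀ n, U' (n + 1) = U' n / (1 + W' n * U' n)) (hWν' : ∀ n, -ν' n ≤ W' n) (hν0' : ∀ n, 0 ≤ ν' n)
    (hsmall' : 16 * U' 0 * ∑ j ∈ range N, ν' j ≤ 1) {n : ℕ} (hn : n ≤ N) {Θ : ℝ}
    (hΘ : ∑ j ∈ range n, (W j - W' j) ≤ Θ) :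
    U' n * (1 - U n * Θ) ≤ U n := by
  have h0'' : 0 ≤ U' 0 := by rw [h0']; exact h0
  have hUn := (sWaveFloor_bounds h0 hU hWν hν0 hsmall n hn).1
  have hUn' := (sWaveFloor_bounds h0'' hU' hWν' hν0' hsmall' n hn).1
  have heq := sWaveFloor_sub_eq h0 h0' hU hWν hν0 hsmall hU' hWν' hν0' hsmall' n hn
  have hs : ∑ j ∈ range n, (W' j - W j) = -∑ j ∈ range n, (W j - W' j) := by
    rw [← sum_neg_distrib]; exact sum_congr rfl fun j _ => by ring
  rw [hs] at heq
  have hp : 0 ≤ U n * U' n := mul_nonneg hUn hUn'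
  have hkey : U n * U' n * ∑ j ∈ range n, (W j - W' j) ≤ U n * U' n * Θ := mul_le_mul_of_nonneg_left hΘ hp
  nlinarith [hkey, heq]

/-- **Shortfall comparison, multiplicative form.**  Under the hypotheses of `sWaveFloor_le_of_shortfall` with `Θ ≥ 0`, for every `D ≥ 1` with
`D·(16U_0/15)·Θ ≤ D − 1` (e.g. `D = 2` when `(32/15)·U_0·Θ ≤ 1`): `U'_n ≤ D·U_n`. [folklore] -/
theorem sWaveFloor_le_mul_of_shortfall (h0 : 0 ≤ U 0) (h0' : U' 0 = U 0)
    (hU : ∀ n, U (n + 1) = U n / (1 + W n * U n)) (hWν : ∀ n, -ν n ≤ W n) (hν0 : ∀ n, 0 ≤ ν n)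
    (hsmall : 16 * U 0 * ∑ j ∈ range N, ν j ≤ 1)
    (hU' : ∀ n, U' (n + 1) = U' n / (1 + W' n * U' n)) (hWν' : ∀ n, -ν' n ≤ W' n) (hν0' : ∀ n, 0 ≤ ν' n)
    (hsmall' : 16 * U' 0 * ∑ j ∈ range N, ν' j ≤ 1) {n : ℕ} (hn : n ≤ N) {Θ D : ℝ} (hΘ0 : 0 ≤ Θ) (hD : 1 ≤ D)
    (hDΘ : D * (16 / 15 * U 0 * Θ) ≤ D - 1) (hΘ : ∑ j ∈ range n, (W j - W' j) ≤ Θ) :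
    U' n ≤ D * U n := by
  have h0'' : 0 ≤ U' 0 := by rw [h0']; exact h0
  have h1 := sWaveFloor_le_of_shortfall h0 h0' hU hWν hν0 hsmall hU' hWν' hν0' hsmall' hn hΘ
  obtain ⟨hUn, hUnle⟩ := sWaveFloor_bounds h0 hU hWν hν0 hsmall n hn
  have hUn' := (sWaveFloor_bounds h0'' hU' hWν' hν0' hsmall' n hn).1
  have hc : U n * Θ ≤ 16 / 15 * U 0 * Θ := mul_le_mul_of_nonneg_right hUnle hΘ0
  have h3 : D * (U n * Θ) ≤ D * (16 / 15 * U 0 * Θ) := mul_le_mul_of_nonneg_left hc (by linarith)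
  have h2 : 1 ≤ D * (1 - U n * Θ) := by nlinarith
  calc U' n = U' n * 1 := (mul_one _).symm
    _ ≤ U' n * (D * (1 - U n * Θ)) := mul_le_mul_of_nonneg_left h2 hUn'
    _ = D * (U' n * (1 - U n * Θ)) := by ring
    _ ≤ D * U n := mul_le_mul_of_nonneg_left h1 (by linarith)

/-- **Dominated decrement.**  Two cascades from the same `U_0 ≥ 0` under the floor, `n < N`; if the shortfall is `≤ Θ` before AND after step `n`
(`Σ_{j<n}`, `Σ_{j<n+1}`), `D ≥ 1` with `D·(16U_0/15)·Θ ≤ D − 1`, and the transfer's mass at step `n` is dominated by the pinned one, `|W'_n| ≤ κ·|W_n| + η`, then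
`|U'_{n+1} − U'_n| ≤ D²·(κ·|U_{n+1} − U_n| + (16U_0/15)²·η)` — the decrement at the transfer is read at the pin. [folklore] -/
theorem sWaveFloor_succ_sub_dominated (h0 : 0 ≤ U 0) (h0' : U' 0 = U 0)
    (hU : ∀ n, U (n + 1) = U n / (1 + W n * U n)) (hWν : ∀ n, -ν n ≤ W n) (hν0 : ∀ n, 0 ≤ ν n)
    (hsmall : 16 * U 0 * ∑ j ∈ range N, ν j ≤ 1)
    (hU' : ∀ n, U' (n + 1) = U' n / (1 + W' n * U' n)) (hWν' : ∀ n, -ν' n ≤ W' n) (hν0' : ∀ n, 0 ≤ ν' n)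
    (hsmall' : 16 * U' 0 * ∑ j ∈ range N, ν' j ≤ 1) {n : ℕ} (hn : n < N) {Θ D κ η : ℝ} (hΘ0 : 0 ≤ Θ) (hD : 1 ≤ D)
    (hDΘ : D * (16 / 15 * U 0 * Θ) ≤ D - 1) (hκ : 0 ≤ κ) (hη : 0 ≤ η)
    (hΘn : ∑ j ∈ range n, (W j - W' j) ≤ Θ) (hΘn1 : ∑ j ∈ range (n + 1), (W j - W' j) ≤ Θ)
    (hdom : |W' n| ≤ κ * |W n| + η) :
    |U' (n + 1) - U' n| ≤ D ^ 2 * (κ * |U (n + 1) - U n| + (16 / 15 * U 0) ^ 2 * η) := by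
  have h0'' : 0 ≤ U' 0 := by rw [h0']; exact h0
  have hden := (sWaveFloor_step h0 hU hWν hν0 hsmall n hn).1
  have hden' := (sWaveFloor_step h0'' hU' hWν' hν0' hsmall' n hn).1
  have hΔ := sWaveFloor_succ_sub hU hden
  have hΔ' := sWaveFloor_succ_sub hU' hden'
  obtain ⟨hUn, hUnle⟩ := sWaveFloor_bounds h0 hU hWν hν0 hsmall n hn.le
  obtain ⟨hUn1, hUn1le⟩ := sWaveFloor_bounds h0 hU hWν hν0 hsmall (n + 1) (Nat.succ_le_of_lt hn)
  have hU'n := (sWaveFloor_bounds h0'' hU' hWν' hν0' hsmall' n hn.le).1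
  have hU'n1 := (sWaveFloor_bounds h0'' hU' hWν' hν0' hsmall' (n + 1) (Nat.succ_le_of_lt hn)).1
  have hc1 : U' n ≤ D * U n :=
    sWaveFloor_le_mul_of_shortfall h0 h0' hU hWν hν0 hsmall hU' hWν' hν0' hsmall' hn.le hΘ0 hD hDΘ hΘn
  have hc2 : U' (n + 1) ≤ D * U (n + 1) :=
    sWaveFloor_le_mul_of_shortfall h0 h0' hU hWν hν0 hsmall hU' hWν' hν0' hsmall' (Nat.succ_le_of_lt hn) hΘ0 hD hDΘ hΘn1
  have hD0 : 0 ≤ D := by linarith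
  rw [hΔ, hΔ', abs_neg, abs_neg]
  simp only [abs_mul, abs_of_nonneg hUn, abs_of_nonneg hUn1, abs_of_nonneg hU'n, abs_of_nonneg hU'n1]
  have hP' : U' n * U' (n + 1) ≤ D ^ 2 * (U n * U (n + 1)) := by
    calc U' n * U' (n + 1) ≤ (D * U n) * (D * U (n + 1)) := mul_le_mul hc1 hc2 hU'n1 (mul_nonneg hD0 hUn)
      _ = D ^ 2 * (U n * U (n + 1)) := by ring
  have hP : U n * U (n + 1) ≤ (16 / 15 * U 0) ^ 2 := by
    rw [sq]; exact mul_le_mul hUnle hUn1le hUn1 (by positivity)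
  have hdom0 : 0 ≤ κ * |W n| + η := add_nonneg (mul_nonneg hκ (abs_nonneg _)) hη
  calc |W' n| * U' n * U' (n + 1) = |W' n| * (U' n * U' (n + 1)) := by ring
    _ ≤ (κ * |W n| + η) * (D ^ 2 * (U n * U (n + 1))) := mul_le_mul hdom hP' (mul_nonneg hU'n hU'n1) hdom0
    _ = D ^ 2 * (κ * (|W n| * U n * U (n + 1)) + η * (U n * U (n + 1))) := by ring
    _ ≤ D ^ 2 * (κ * (|W n| * U n * U (n + 1)) + η * (16 / 15 * U 0) ^ 2) := by
        refine mul_le_mul_of_nonneg_left (add_le_add le_rfl (mul_le_mul_of_nonneg_left hP hη)) (sq_nonneg _)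
    _ = D ^ 2 * (κ * (|W n| * U n * U (n + 1)) + (16 / 15 * U 0) ^ 2 * η) := by ring

/-- **Dominated total variation.**  Two cascades from the same `U_0 ≥ 0` under the floor; at every step `n < N` EITHER the transfer is frozen (`W'_n = 0`: nothing is asked
— past the class exit) OR its mass is dominated (`|W'_n| ≤ κ|W_n| + η_n`) with the shortfall `≤ Θ` before and after the step.  Then
`Σ_{n<N} |U'_{n+1} − U'_n| ≤ D²·(κ·(257/225)·U_0 + (16U_0/15)²·Σ_{n<N} η_n)`: the transfer's total variation is read at the pin, in `U`-currency. [folklore] -/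
theorem sWaveFloor_totalVariation_dominated (h0 : 0 ≤ U 0) (h0' : U' 0 = U 0)
    (hU : ∀ n, U (n + 1) = U n / (1 + W n * U n)) (hWν : ∀ n, -ν n ≤ W n) (hν0 : ∀ n, 0 ≤ ν n)
    (hsmall : 16 * U 0 * ∑ j ∈ range N, ν j ≤ 1)
    (hU' : ∀ n, U' (n + 1) = U' n / (1 + W' n * U' n)) (hWν' : ∀ n, -ν' n ≤ W' n) (hν0' : ∀ n, 0 ≤ ν' n)
    (hsmall' : 16 * U' 0 * ∑ j ∈ range N, ν' j ≤ 1) {Θ D κ : ℝ} {η : ℕ → ℝ} (hΘ0 : 0 ≤ Θ) (hD : 1 ≤ D)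
    (hDΘ : D * (16 / 15 * U 0 * Θ) ≤ D - 1) (hκ : 0 ≤ κ) (hη : ∀ n, 0 ≤ η n)
    (hstep : ∀ n < N, W' n = 0 ∨
      (|W' n| ≤ κ * |W n| + η n ∧ ∑ j ∈ range n, (W j - W' j) ≤ Θ ∧ ∑ j ∈ range (n + 1), (W j - W' j) ≤ Θ)) :
    ∑ n ∈ range N, |U' (n + 1) - U' n| ≤ D ^ 2 * (κ * (257 / 225 * U 0) + (16 / 15 * U 0) ^ 2 * ∑ n ∈ range N, η n) := by
  have hpt : ∀ n < N, |U' (n + 1) - U' n| ≤ D ^ 2 * (κ * |U (n + 1) - U n| + (16 / 15 * U 0) ^ 2 * η n) := by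
    intro n hn
    rcases hstep n hn with hz | ⟨hdom, hΘn, hΘn1⟩
    · rw [sWaveCascade_succ_eq_of_mass_zero hU' hz, sub_self, abs_zero]
      exact mul_nonneg (sq_nonneg _) (add_nonneg (mul_nonneg hκ (abs_nonneg _)) (mul_nonneg (sq_nonneg _) (hη n)))
    · exact sWaveFloor_succ_sub_dominated h0 h0' hU hWν hν0 hsmall hU' hWν' hν0' hsmall' hn hΘ0 hD hDΘ hκ (hη n) hΘn hΘn1 hdom
  have hTV := sWaveFloor_totalVariation_le' h0 hU hWν hν0 hsmall
  calc ∑ n ∈ range N, |U' (n + 1) - U' n|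
      ≤ ∑ n ∈ range N, D ^ 2 * (κ * |U (n + 1) - U n| + (16 / 15 * U 0) ^ 2 * η n) := sum_le_sum fun n hn => hpt n (mem_range.1 hn)
    _ = D ^ 2 * (κ * ∑ n ∈ range N, |U (n + 1) - U n| + (16 / 15 * U 0) ^ 2 * ∑ n ∈ range N, η n) := by
        rw [← mul_sum, sum_add_distrib, ← mul_sum, ← mul_sum]
    _ ≤ D ^ 2 * (κ * (257 / 225 * U 0) + (16 / 15 * U 0) ^ 2 * ∑ n ∈ range N, η n) :=
        mul_le_mul_of_nonneg_left (add_le_add (mul_le_mul_of_nonneg_left hTV hκ) le_rfl) (sq_nonneg _)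

end Scalar

/-! ## §2 The family form: amplitudes read at the pin, uniform over dominated transfers -/

section Family

variable {ι : Type*} {Uq Wq νq : ι → ℕ → ℝ} {U₀ : ℝ} {N : ℕ}

/-- **Decrement domination in a family of cascades** indexed by transfers `q : ι` with a pin `o`: all cascades start at `U₀ ≥ 0` and obey the law and the floor; a transfer
`q` whose every step `n < N` is frozen or dominated by the pin (mass `|W_q(n)| ≤ κ|W_o(n)| + η_n`, shortfall `Σ_{j<m}(W_o(j) − W_q(j)) ≤ Θ` for `m = n, n+1`) has
`|U_q(n+1) − U_q(n)| ≤ D²(κ·|U_o(n+1) − U_o(n)| + (16U₀/15)²·η_n)` at every `n < N` and total variation `≤ D²(κ·(257/225)·U₀ + (16U₀/15)²·Ση)`. [folklore] -/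
theorem cascadeFamily_decrement_dominated (o q : ι) (hU₀ : 0 ≤ U₀) (h0 : ∀ q, Uq q 0 = U₀)
    (hU : ∀ q n, Uq q (n + 1) = Uq q n / (1 + Wq q n * Uq q n)) (hWν : ∀ q n, -νq q n ≤ Wq q n) (hν0 : ∀ q n, 0 ≤ νq q n)
    (hsmall : ∀ q, 16 * U₀ * ∑ j ∈ range N, νq q j ≤ 1) {Θ D κ : ℝ} {η : ℕ → ℝ} (hΘ0 : 0 ≤ Θ) (hD : 1 ≤ D)
    (hDΘ : D * (16 / 15 * U₀ * Θ) ≤ D - 1) (hκ : 0 ≤ κ) (hη : ∀ n, 0 ≤ η n)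
    (hstep : ∀ n < N, Wq q n = 0 ∨
      (|Wq q n| ≤ κ * |Wq o n| + η n ∧ ∑ j ∈ range n, (Wq o j - Wq q j) ≤ Θ ∧ ∑ j ∈ range (n + 1), (Wq o j - Wq q j) ≤ Θ)) :
    (∀ n < N, |Uq q (n + 1) - Uq q n| ≤ D ^ 2 * (κ * |Uq o (n + 1) - Uq o n| + (16 / 15 * U₀) ^ 2 * η n)) ∧
      ∑ n ∈ range N, |Uq q (n + 1) - Uq q n| ≤ D ^ 2 * (κ * (257 / 225 * U₀) + (16 / 15 * U₀) ^ 2 * ∑ n ∈ range N, η n) := by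
  have ho0 : 0 ≤ Uq o 0 := by rw [h0 o]; exact hU₀
  have hqo : Uq q 0 = Uq o 0 := by rw [h0 q, h0 o]
  have hsmo : 16 * Uq o 0 * ∑ j ∈ range N, νq o j ≤ 1 := by rw [h0 o]; exact hsmall o
  have hsmq : 16 * Uq q 0 * ∑ j ∈ range N, νq q j ≤ 1 := by rw [h0 q]; exact hsmall q
  have hDΘ' : D * (16 / 15 * Uq o 0 * Θ) ≤ D - 1 := by rw [h0 o]; exact hDΘ
  refine ⟨fun n hn => ?_, ?_⟩
  · rcases hstep n hn with hz | ⟨hdom, hΘn, hΘn1⟩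
    · rw [sWaveCascade_succ_eq_of_mass_zero (hU q) hz, sub_self, abs_zero]
      exact mul_nonneg (sq_nonneg _) (add_nonneg (mul_nonneg hκ (abs_nonneg _)) (mul_nonneg (sq_nonneg _) (hη n)))
    · have h := sWaveFloor_succ_sub_dominated ho0 hqo (hU o) (hWν o) (hν0 o) hsmo (hU q) (hWν q) (hν0 q) hsmq hn hΘ0 hD hDΘ' hκ
        (hη n) hΘn hΘn1 hdom
      rw [h0 o] at h
      exact h
  · have h := sWaveFloor_totalVariation_dominated ho0 hqo (hU o) (hWν o) (hν0 o) hsmo (hU q) (hWν q) (hν0 q) hsmq hΘ0 hD hDΘ' hκ hη hstep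
    rw [h0 o] at h
    exact h

/-- **Amplitudes read at the pin** (the (s2) «SUP-VS-PIN» shape): in a family of cascades as above there are nonnegative amplitudes `a_n` — namely
`a_n = D²(κ·|U_o(n+1) − U_o(n)| + (16U₀/15)²·η_n)`, functions of the PINNED cascade alone — with `|U_q(n+1) − U_q(n)| ≤ a_n` for every `n < N` and every transfer `q`
frozen-or-dominated at every step, and `Σ_{n<N} a_n ≤ D²(κ·(257/225)·U₀ + (16U₀/15)²·Σ_{n<N} η_n)` (`U`-currency).  With `G_n(q) := (U_q(n+1) − U_q(n))/a_n` this is the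
superposition datum `Σ_n ‖a_n‖·sup|G_n| ≤ V` of the plain-line brick (T2). [folklore] -/
theorem cascadeFamily_exists_pinnedAmplitude (o : ι) (hU₀ : 0 ≤ U₀) (h0 : ∀ q, Uq q 0 = U₀)
    (hU : ∀ q n, Uq q (n + 1) = Uq q n / (1 + Wq q n * Uq q n)) (hWν : ∀ q n, -νq q n ≤ Wq q n) (hν0 : ∀ q n, 0 ≤ νq q n)
    (hsmall : ∀ q, 16 * U₀ * ∑ j ∈ range N, νq q j ≤ 1) {Θ D κ : ℝ} {η : ℕ → ℝ} (hΘ0 : 0 ≤ Θ) (hD : 1 ≤ D)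
    (hDΘ : D * (16 / 15 * U₀ * Θ) ≤ D - 1) (hκ : 0 ≤ κ) (hη : ∀ n, 0 ≤ η n) :
    ∃ a : ℕ → ℝ, (∀ n, 0 ≤ a n) ∧
      (∀ q, (∀ n < N, Wq q n = 0 ∨
          (|Wq q n| ≤ κ * |Wq o n| + η n ∧ ∑ j ∈ range n, (Wq o j - Wq q j) ≤ Θ ∧ ∑ j ∈ range (n + 1), (Wq o j - Wq q j) ≤ Θ)) →
        ∀ n < N, |Uq q (n + 1) - Uq q n| ≤ a n) ∧
      ∑ n ∈ range N, a n ≤ D ^ 2 * (κ * (257 / 225 * U₀) + (16 / 15 * U₀) ^ 2 * ∑ n ∈ range N, η n) := by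
  refine ⟨fun n => D ^ 2 * (κ * |Uq o (n + 1) - Uq o n| + (16 / 15 * U₀) ^ 2 * η n),
    fun n => mul_nonneg (sq_nonneg _) (add_nonneg (mul_nonneg hκ (abs_nonneg _)) (mul_nonneg (sq_nonneg _) (hη n))),
    fun q hq => (cascadeFamily_decrement_dominated o q hU₀ h0 hU hWν hν0 hsmall hΘ0 hD hDΘ hκ hη hq).1, ?_⟩
  -- the pinned cascade's own total variation
  have ho0 : 0 ≤ Uq o 0 := by rw [h0 o]; exact hU₀
  have hsmo : 16 * Uq o 0 * ∑ j ∈ range N, νq o j ≤ 1 := by rw [h0 o]; exact hsmall o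
  have hTV := sWaveFloor_totalVariation_le' ho0 (hU o) (hWν o) (hν0 o) hsmo
  rw [h0 o] at hTV
  calc ∑ n ∈ range N, D ^ 2 * (κ * |Uq o (n + 1) - Uq o n| + (16 / 15 * U₀) ^ 2 * η n)
      = D ^ 2 * (κ * ∑ n ∈ range N, |Uq o (n + 1) - Uq o n| + (16 / 15 * U₀) ^ 2 * ∑ n ∈ range N, η n) := by
        rw [← mul_sum, sum_add_distrib, ← mul_sum, ← mul_sum]
    _ ≤ D ^ 2 * (κ * (257 / 225 * U₀) + (16 / 15 * U₀) ^ 2 * ∑ n ∈ range N, η n) :=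
        mul_le_mul_of_nonneg_left (add_le_add (mul_le_mul_of_nonneg_left hTV hκ) le_rfl) (sq_nonneg _)

/-- The `D = 2` instance: under `(32/15)·U₀·Θ ≤ 1` the amplitudes read at the pin are `a_n = 4(κ·|U_o(n+1) − U_o(n)| + (16U₀/15)²·η_n)` with
`Σ_{n<N} a_n ≤ 4(κ·(257/225)·U₀ + (16U₀/15)²·Ση)`. [folklore] -/
theorem cascadeFamily_exists_pinnedAmplitude_two (o : ι) (hU₀ : 0 ≤ U₀) (h0 : ∀ q, Uq q 0 = U₀)
    (hU : ∀ q n, Uq q (n + 1) = Uq q n / (1 + Wq q n * Uq q n)) (hWν : ∀ q n, -νq q n ≤ Wq q n) (hν0 : ∀ q n, 0 ≤ νq q n)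
    (hsmall : ∀ q, 16 * U₀ * ∑ j ∈ range N, νq q j ≤ 1) {Θ κ : ℝ} {η : ℕ → ℝ} (hΘ0 : 0 ≤ Θ) (hΘ : 32 / 15 * U₀ * Θ ≤ 1)
    (hκ : 0 ≤ κ) (hη : ∀ n, 0 ≤ η n) :
    ∃ a : ℕ → ℝ, (∀ n, 0 ≤ a n) ∧
      (∀ q, (∀ n < N, Wq q n = 0 ∨
          (|Wq q n| ≤ κ * |Wq o n| + η n ∧ ∑ j ∈ range n, (Wq o j - Wq q j) ≤ Θ ∧ ∑ j ∈ range (n + 1), (Wq o j - Wq q j) ≤ Θ)) →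
        ∀ n < N, |Uq q (n + 1) - Uq q n| ≤ a n) ∧
      ∑ n ∈ range N, a n ≤ 4 * (κ * (257 / 225 * U₀) + (16 / 15 * U₀) ^ 2 * ∑ n ∈ range N, η n) := by
  have hDΘ : (2 : ℝ) * (16 / 15 * U₀ * Θ) ≤ 2 - 1 := by linarith
  obtain ⟨a, ha0, ha, hsum⟩ := cascadeFamily_exists_pinnedAmplitude o hU₀ h0 hU hWν hν0 hsmall hΘ0 (by norm_num : (1 : ℝ) ≤ 2) hDΘ hκ hη
  exact ⟨a, ha0, ha, hsum.trans (by norm_num)⟩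

end Family

/-! ## §3 The free envelope plus a PINNED SCREENING FLOOR give the domination (appended, same seat):
`|W_q(n)| ≤ b_M` (the ℓ¹ line of the ladder weights, already in the (E2-F2) clause) and `0 < b_lo ≤ W_o(n)` (the Cooper logarithm at zero transfer)
⟹ (D1) with `κ = b_M/b_lo`, `η = 0`; so the E1 producer owes exactly the shortfall (D2) and the pinned floor (D3) -/

section Floor

variable {ι : Type*} {Uq Wq νq : ι → ℕ → ℝ} {U₀ : ℝ} {N : ℕ}

/-- The mass envelope and a pinned floor give ratio domination: `|W'| ≤ b_M`, `0 < b_lo ≤ W` ⟹ `|W'| ≤ (b_M/b_lo)·|W| + 0`. [folklore] -/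
theorem abs_le_ratio_mul_abs_of_floor {W W' bM blo : ℝ} (hW' : |W'| ≤ bM) (hblo : 0 < blo) (hW : blo ≤ W) :
    |W'| ≤ bM / blo * |W| + 0 := by
  rw [add_zero, abs_of_pos (hblo.trans_le hW)]
  have hbM : 0 ≤ bM := (abs_nonneg _).trans hW'
  calc |W'| ≤ bM := hW'
    _ = bM / blo * blo := by field_simp
    _ ≤ bM / blo * W := mul_le_mul_of_nonneg_left hW (div_nonneg hbM hblo.le)

/-- **Amplitudes read at the pin from the envelope, the shortfall and the PINNED SCREENING FLOOR.**  A family of cascades as in §2 (common start `U₀ ≥ 0`, the law,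
the floor); every transfer's masses obey the free envelope `|W_q(n)| ≤ b_M`; the PINNED masses obey `0 < b_lo ≤ W_o(n)` for `n < N`.  Then there are amplitudes
`a_n = D²·(b_M/b_lo)·|U_o(n+1) − U_o(n)|` with `|U_q(n+1) − U_q(n)| ≤ a_n` (`n < N`) for every transfer `q` whose every step is frozen (`W_q(n) = 0`) or has shortfall
`Σ_{j<m}(W_o(j) − W_q(j)) ≤ Θ` (`m = n, n+1`), and `Σ_{n<N} a_n ≤ D²·(b_M/b_lo)·(257/225)·U₀` — (s2) from (D2) + (D3) alone. [folklore] -/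
theorem cascadeFamily_exists_pinnedAmplitude_of_floor (o : ι) (hU₀ : 0 ≤ U₀) (h0 : ∀ q, Uq q 0 = U₀)
    (hU : ∀ q n, Uq q (n + 1) = Uq q n / (1 + Wq q n * Uq q n)) (hWν : ∀ q n, -νq q n ≤ Wq q n) (hν0 : ∀ q n, 0 ≤ νq q n)
    (hsmall : ∀ q, 16 * U₀ * ∑ j ∈ range N, νq q j ≤ 1) {Θ D bM blo : ℝ} (hΘ0 : 0 ≤ Θ) (hD : 1 ≤ D)
    (hDΘ : D * (16 / 15 * U₀ * Θ) ≤ D - 1) (henv : ∀ q n, |Wq q n| ≤ bM) (hblo : 0 < blo) (hfloor : ∀ n < N, blo ≤ Wq o n) :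
    ∃ a : ℕ → ℝ, (∀ n, 0 ≤ a n) ∧
      (∀ q, (∀ n < N, Wq q n = 0 ∨
          (∑ j ∈ range n, (Wq o j - Wq q j) ≤ Θ ∧ ∑ j ∈ range (n + 1), (Wq o j - Wq q j) ≤ Θ)) →
        ∀ n < N, |Uq q (n + 1) - Uq q n| ≤ a n) ∧
      ∑ n ∈ range N, a n ≤ D ^ 2 * (bM / blo * (257 / 225 * U₀)) := by
  have hκ : 0 ≤ bM / blo := div_nonneg ((abs_nonneg _).trans (henv o 0)) hblo.le
  obtain ⟨a, ha0, ha, hsum⟩ :=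
    cascadeFamily_exists_pinnedAmplitude o hU₀ h0 hU hWν hν0 hsmall hΘ0 hD hDΘ hκ (η := fun _ => 0) (fun _ => le_rfl)
  refine ⟨a, ha0, fun q hq => ha q fun n hn => ?_, ?_⟩
  · rcases hq n hn with hz | ⟨h1, h2⟩
    · exact Or.inl hz
    · exact Or.inr ⟨abs_le_ratio_mul_abs_of_floor (henv q n) hblo (hfloor n hn), h1, h2⟩
  · simpa using hsum

end Floor

end Summit.HubbardSuperconductivity.HubbardSuperconductivity.Theorems.SWaveCascade

end
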